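import Literature.AnabelianGeometry.EtaleTheta.Discharge.Sec1Prop13Rmk131Schema
import Literature.AnabelianGeometry.EtaleTheta.Discharge.Sec1Prop15Schema
import Literature.AnabelianGeometry.EtaleTheta.Discharge.Sec1Prop15iiSchema
import Literature.AnabelianGeometry.EtaleTheta.Discharge.Sec1ConstCompatSchema
import Literature.AnabelianGeometry.EtaleTheta.SettingModelChiKummerData
import HarnessLib

/-!
# [EtTh] §1 Kummer-level schema rows: the universal closures are REFUTED in the kernel, unconditionally
# (FACT-LIST F-2492 `Prop13`, F-0523 `Rmk131`, F-2502 `Prop15i`, F-2503 `Prop15ii`, F-0618 `ConstCompat`)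

Mochizuki, *The étale theta function …*, Publ. RIMS **45** (2009) [EtTh], §1, Prop. 1.3 "(The Étale Theta Class)"
PRIMS PDF pp. 19–21, Rmk. 1.3.1 p. 21 ("the denominators `½` … are by no means superfluous"), Prop. 1.5 (i), (ii)
pp. 22–23 ("`F² = H¹(G_K, Δ_Θ) →̃ (K^×)^∧`", "`F¹/F² = Ẑ · log(U)`"), and the constant-multiple Kummer
compatibility of the theta class p. 21 [cite: MochizukiEtTh2009, Prop 1.3 p.20].

PROOF-ONLY companion (abc-iut cell, block F fact-proving wave, seat abc-iut-f-117 gen 4; no `def`, no instance, no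
Prop fact).  The lineage's schema files proved the EXACT kernel reductions of the universal closures of the five
`E`-indexed resp. `K`-indexed §1 predicates to ONE sentence — "no theta setting (at an [EtTh] origin with `Compat`) carries Kummer
data":

* `ThetaSetting.forall_prop13_iff_forall_isEmpty_kummerData`, `forall_rmk131_iff_forall_isEmpty_kummerData`
  (`Discharge/Sec1Prop13Rmk131Schema.lean`, p428056);
* `ThetaSetting.forall_prop15i_iff_forall_isEmpty_kummerData` (`Discharge/Sec1Prop15Schema.lean`, p429009),
  `forall_prop15ii_iff_forall_isEmpty_kummerData` (`Discharge/Sec1Prop15iiSchema.lean`, p430194) — guarded by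
  `Compat` and `IsEtThOrigin`;
* `ThetaSetting.forall_constCompat_iff_forall_isEmpty_kummerData` (`Discharge/Sec1ConstCompatSchema.lean`, p429630).

When those files landed (06–07Z, 2026-08-26) the only setting in the tree, the root model `ThetaSetting.model p`,
carried NO Kummer data (`ThetaSetting.model_isEmpty_kummerData`), so the closures were reduced but not decided.
Since then abc-iut-w5-d171 (R78 cluster, file F6 (c), p433761) constructed
**`SettingModel.kummerDataχ p : (ThetaSetting.modelχ p).KummerData`** over abc-iut-L2-t1's χ-twisted root model
`ThetaSetting.modelχ p` (p433524), a setting satisfying the guard `ThetaSetting.modelχ_isEtThOrigin` and — like every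
setting — `ThetaSetting.compat`.  THIS FILE performs the one-line fold: for EVERY prime `p` the five closures over
`ThetaSetting p` are false (`not_forall_prop13_at`, …), hence the full universal closures over all binders are false
(`not_forall_prop13`, `not_forall_rmk131`, `not_forall_prop15i`, `not_forall_prop15ii`, `not_forall_constCompat` —
statements whose body HEAD is the row's declaration applied to distinct bound variables), together with the dual
instance-level existence forms AT `modelχ` and the non-vacuity of the typed predicates `Prop13 ∧ Rmk131` there.

HONEST FRAMING.  These are statements about the TYPED predicates over abstract / semi-synthetic data: the universal
closure of a schema row was never a printed claim (plan/FACT-LIST.md header rule R5, director CYCLE-7 (2) class (a));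
`modelχ` is a semi-synthetic consistency model (abc-iut-L6-d6's label «split-Tate»), not the tempered fundamental
group of a curve; the non-vacuity witness for `Prop13 ∧ Rmk131` uses the FREE abstract `½`-coefficient fields of
`EtaleThetaData` chosen trivially and is NOT the R78 F7b datum `EtaleThetaData` at `modelχ` (abc-iut-L2-t6), which
models `η̈^Θ` genuinely.  Nothing of [EtTh] is asserted or denied; no side is taken on [IUTchIII] Cor. 3.12;
typed ≠ proved; a FACT row is an assumption label.
-/

noncomputable section

namespace Literature.AnabelianGeometry.EtaleTheta

open Literature.AnabelianGeometry.SemiGraphs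

namespace ThetaSetting

/-! ### The pivot: some guarded theta setting carries Kummer data -/

/-- **For every prime `p` some theta setting over `p` at an [EtTh] origin (with `Compat`) carries Kummer data** —
the χ-twisted root model with `SettingModel.kummerDataχ`. [cite: MochizukiEtTh2009, Prop 1.5 p.23] -/
theorem exists_isEtThOrigin_nonempty_kummerData (p : ℕ) [Fact p.Prime] :
    ∃ D : ThetaSetting p, D.Compat ∧ D.IsEtThOrigin ∧ Nonempty D.KummerData :=
  ⟨ThetaSetting.modelχ p, (ThetaSetting.modelχ p).compat, ThetaSetting.modelχ_isEtThOrigin p,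
    SettingModel.nonempty_kummerData_modelχ p⟩

/-- Hence it is FALSE that every theta setting over `p` has empty Kummer data.
[cite: MochizukiEtTh2009, Prop 1.5 p.23] -/
theorem not_forall_isEmpty_kummerData_at (p : ℕ) [Fact p.Prime] :
    ¬ ∀ D : ThetaSetting p, IsEmpty D.KummerData := fun h =>
  (h (ThetaSetting.modelχ p)).false (SettingModel.kummerDataχ p)

/-- … and FALSE that every guarded theta setting over `p` has empty Kummer data (the guarded pivot of the
Prop. 1.5 reductions). [cite: MochizukiEtTh2009, Prop 1.5 p.23] -/
theorem not_forall_guarded_isEmpty_kummerData_at (p : ℕ) [Fact p.Prime] :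
    ¬ ∀ D : ThetaSetting p, D.Compat → D.IsEtThOrigin → IsEmpty D.KummerData := fun h =>
  (h (ThetaSetting.modelχ p) (ThetaSetting.modelχ p).compat (ThetaSetting.modelχ_isEtThOrigin p)).false
    (SettingModel.kummerDataχ p)

/-- The all-primes pivot is false as well (instantiate at `p = 2`). [cite: MochizukiEtTh2009, Prop 1.5 p.23] -/
theorem not_forall_isEmpty_kummerData :
    ¬ ∀ (p : ℕ) [Fact p.Prime] (D : ThetaSetting p), IsEmpty D.KummerData := fun h =>
  not_forall_isEmpty_kummerData_at 2 (h 2)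

/-- The guarded all-primes pivot is false. [cite: MochizukiEtTh2009, Prop 1.5 p.23] -/
theorem not_forall_guarded_isEmpty_kummerData :
    ¬ ∀ (p : ℕ) [Fact p.Prime] (D : ThetaSetting p), D.Compat → D.IsEtThOrigin → IsEmpty D.KummerData :=
  fun h => not_forall_guarded_isEmpty_kummerData_at 2 (h 2)

/-! ### F-2492 `Prop13`: universal closure REFUTED -/

/-- **F-2492, per prime**: Prop. 1.3 as typed does NOT hold for all theta settings over `p` and all étale-theta
data (it fails for suitable data over `kummerDataχ`). [cite: MochizukiEtTh2009, Prop 1.3 p.20] -/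
theorem not_forall_prop13_at (p : ℕ) [Fact p.Prime] :
    ¬ ∀ (D : ThetaSetting p) (E : D.EtaleThetaData), Prop13 E := fun h =>
  not_forall_isEmpty_kummerData_at p fun D => (forall_prop13_iff_isEmpty_kummerData D).mp (h D)

/-- **F-2492, universal closure REFUTED**: Prop. 1.3 as typed (`ThetaSetting.Prop13`) is not true for all primes,
all theta settings and all étale-theta data. [cite: MochizukiEtTh2009, Prop 1.3 p.20] -/
theorem not_forall_prop13 :
    ¬ ∀ (p : ℕ) [Fact p.Prime] (D : ThetaSetting p) (E : D.EtaleThetaData), Prop13 E := fun h =>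
  not_forall_prop13_at 2 (h 2)

/-- **F-2492, instance level at `modelχ`**: some étale-theta datum over the χ-twisted root model violates
Prop. 1.3 as typed. [cite: MochizukiEtTh2009, Prop 1.3 p.20] -/
theorem modelχ_exists_not_prop13 (p : ℕ) [Fact p.Prime] :
    ∃ E : (ThetaSetting.modelχ p).EtaleThetaData, ¬ Prop13 E :=
  (exists_not_prop13_iff_nonempty_kummerData _).mpr (SettingModel.nonempty_kummerData_modelχ p)

/-! ### F-0523 `Rmk131`: universal closure REFUTED -/

/-- **F-0523, per prime**: Rmk. 1.3.1 as typed does NOT hold for all theta settings over `p` and all étale-theta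
data. [cite: MochizukiEtTh2009, Rmk 1.3.1 p.21] -/
theorem not_forall_rmk131_at (p : ℕ) [Fact p.Prime] :
    ¬ ∀ (D : ThetaSetting p) (E : D.EtaleThetaData), Rmk131 E := fun h =>
  not_forall_isEmpty_kummerData_at p fun D => (forall_rmk131_iff_isEmpty_kummerData D).mp (h D)

/-- **F-0523, universal closure REFUTED**: Rmk. 1.3.1 as typed (`ThetaSetting.Rmk131`) is not true for all primes,
all theta settings and all étale-theta data. [cite: MochizukiEtTh2009, Rmk 1.3.1 p.21] -/
theorem not_forall_rmk131 :
    ¬ ∀ (p : ℕ) [Fact p.Prime] (D : ThetaSetting p) (E : D.EtaleThetaData), Rmk131 E := fun h =>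
  not_forall_rmk131_at 2 (h 2)

/-- **F-0523, instance level at `modelχ`**: some étale-theta datum over the χ-twisted root model violates
Rmk. 1.3.1 as typed. [cite: MochizukiEtTh2009, Rmk 1.3.1 p.21] -/
theorem modelχ_exists_not_rmk131 (p : ℕ) [Fact p.Prime] :
    ∃ E : (ThetaSetting.modelχ p).EtaleThetaData, ¬ Rmk131 E :=
  (exists_not_rmk131_iff_nonempty_kummerData _).mpr (SettingModel.nonempty_kummerData_modelχ p)

/-- **Non-vacuity of the typed predicates at `modelχ`**: some étale-theta datum over the χ-twisted root model —
with Kummer part a genuine `KummerData` of `modelχ` and the free abstract `½`-coefficient fields chosen trivially —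
satisfies Prop. 1.3 ∧ Rmk. 1.3.1 as typed (contrast: at the untwisted root model NO datum does,
`model_not_exists_prop13_and_rmk131`).  Typed-predicate non-vacuity only; not the R78 F7b datum.
[cite: MochizukiEtTh2009, Prop 1.3 p.20] -/
theorem modelχ_exists_prop13_and_rmk131 (p : ℕ) [Fact p.Prime] :
    ∃ E : (ThetaSetting.modelχ p).EtaleThetaData, Prop13 E ∧ Rmk131 E :=
  (exists_prop13_and_rmk131_iff_nonempty_kummerData _).mpr (SettingModel.nonempty_kummerData_modelχ p)

/-- The same witness may be taken over the NAMED Kummer datum `kummerDataχ`. [cite: MochizukiEtTh2009, Prop 1.3 p.20] -/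
theorem kummerDataχ_exists_prop13_and_rmk131 (p : ℕ) [Fact p.Prime] :
    ∃ E : (ThetaSetting.modelχ p).EtaleThetaData,
      E.toKummerData = SettingModel.kummerDataχ p ∧ Prop13 E ∧ Rmk131 E :=
  (SettingModel.kummerDataχ p).exists_etaleThetaData_prop13_and_rmk131

/-- All four truth-value combinations of (Prop. 1.3, Rmk. 1.3.1) as typed occur over `kummerDataχ` — at a setting
WITH Kummer data the two typed predicates are independent constraints on the abstract fields.
[cite: MochizukiEtTh2009, Prop 1.3 p.20] -/
theorem kummerDataχ_prop13_rmk131_independent (p : ℕ) [Fact p.Prime] (a b : Bool) :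
    ∃ E : (ThetaSetting.modelχ p).EtaleThetaData,
      E.toKummerData = SettingModel.kummerDataχ p ∧ (Prop13 E ↔ a = true) ∧ (Rmk131 E ↔ b = true) := by
  obtain ⟨E, hE, h13, h131⟩ :=
    (SettingModel.kummerDataχ p).exists_etaleThetaData_prop13_iff_rmk131_iff
      (if a then 1 else Multiplicative.ofAdd 1) (if b then Multiplicative.ofAdd 1 else 1)
  refine ⟨E, hE, h13.trans ?_, h131.trans ?_⟩ <;> cases a <;> cases b <;> decide

/-! ### F-2502 `Prop15i`: universal closure REFUTED -/

/-- Under the origin guard, some Kummer datum over `D` violates Prop. 1.5 (i) as typed iff `D` carries Kummer data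
(if the given datum satisfies (i), its `log(Θ)`-twist does not: `KummerData.exists_kummerData_not_prop15i`).
[cite: MochizukiEtTh2009, Prop 1.5 (i) p.23] -/
theorem exists_not_prop15i_iff_nonempty_kummerData {p : ℕ} [Fact p.Prime] (D : ThetaSetting p)
    (hC : D.Compat) (hO : D.IsEtThOrigin) :
    (∃ K : D.KummerData, ¬ Prop15i K hC) ↔ Nonempty D.KummerData := by
  refine ⟨fun ⟨K, _⟩ => ⟨K⟩, fun ⟨K⟩ => ?_⟩
  by_cases hK : Prop15i K hC
  · exact K.exists_kummerData_not_prop15i hC hO hK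
  · exact ⟨K, hK⟩

/-- **F-2502, per prime (guarded binders)**: Prop. 1.5 (i) as typed does NOT hold for all theta settings over `p`
at an [EtTh] origin with `Compat` and all Kummer data. [cite: MochizukiEtTh2009, Prop 1.5 (i) p.23] -/
theorem not_forall_prop15i_guarded_at (p : ℕ) [Fact p.Prime] :
    ¬ ∀ (D : ThetaSetting p) (hC : D.Compat) (_ : D.IsEtThOrigin) (K : D.KummerData), Prop15i K hC := fun h =>
  not_forall_guarded_isEmpty_kummerData_at p fun D hC hO =>
    (D.forall_prop15i_iff_isEmpty_kummerData hC hO).mp (h D hC hO)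

/-- **F-2502, per prime**: Prop. 1.5 (i) as typed does NOT hold for all theta settings over `p`, all `Compat`
witnesses and all Kummer data. [cite: MochizukiEtTh2009, Prop 1.5 (i) p.23] -/
theorem not_forall_prop15i_at (p : ℕ) [Fact p.Prime] :
    ¬ ∀ (D : ThetaSetting p) (hC : D.Compat) (K : D.KummerData), Prop15i K hC := fun h =>
  not_forall_prop15i_guarded_at p fun D hC _ K => h D hC K

/-- **F-2502, universal closure REFUTED**: Prop. 1.5 (i) as typed (`ThetaSetting.Prop15i`) is not true for all
primes, all theta settings, all `Compat` witnesses and all Kummer data. [cite: MochizukiEtTh2009, Prop 1.5 (i) p.23] -/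
theorem not_forall_prop15i :
    ¬ ∀ (p : ℕ) [Fact p.Prime] (D : ThetaSetting p) (hC : D.Compat) (K : D.KummerData), Prop15i K hC :=
  fun h => not_forall_prop15i_at 2 (h 2)

/-- **F-2502, guarded universal closure REFUTED** (the left-hand side of
`forall_prop15i_iff_forall_isEmpty_kummerData`). [cite: MochizukiEtTh2009, Prop 1.5 (i) p.23] -/
theorem not_forall_prop15i_guarded :
    ¬ ∀ (p : ℕ) [Fact p.Prime] (D : ThetaSetting p) (hC : D.Compat) (_ : D.IsEtThOrigin) (K : D.KummerData),
        Prop15i K hC :=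
  fun h => not_forall_prop15i_guarded_at 2 (h 2)

/-- **F-2502, instance level at `modelχ`**: some Kummer datum over the χ-twisted root model violates Prop. 1.5 (i)
as typed (for the setting's `Compat` witness). [cite: MochizukiEtTh2009, Prop 1.5 (i) p.23] -/
theorem modelχ_exists_not_prop15i (p : ℕ) [Fact p.Prime] :
    ∃ K : (ThetaSetting.modelχ p).KummerData, ¬ Prop15i K (ThetaSetting.modelχ p).compat :=
  (exists_not_prop15i_iff_nonempty_kummerData _ _ (ThetaSetting.modelχ_isEtThOrigin p)).mpr
    (SettingModel.nonempty_kummerData_modelχ p)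

/-! ### F-2503 `Prop15ii`: universal closure REFUTED -/

/-- **F-2503, per prime (guarded binders)**: Prop. 1.5 (ii) as typed does NOT hold for all theta settings over
`p` at an [EtTh] origin with `Compat` and all Kummer data. [cite: MochizukiEtTh2009, Prop 1.5 (ii) p.23] -/
theorem not_forall_prop15ii_guarded_at (p : ℕ) [Fact p.Prime] :
    ¬ ∀ (D : ThetaSetting p) (hC : D.Compat) (_ : D.IsEtThOrigin) (K : D.KummerData), Prop15ii K hC := fun h =>
  not_forall_guarded_isEmpty_kummerData_at p fun D hC hO =>
    (D.forall_prop15ii_iff_isEmpty_kummerData hC hO).mp (h D hC hO)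

/-- **F-2503, per prime**: Prop. 1.5 (ii) as typed does NOT hold for all theta settings over `p`, all `Compat`
witnesses and all Kummer data. [cite: MochizukiEtTh2009, Prop 1.5 (ii) p.23] -/
theorem not_forall_prop15ii_at (p : ℕ) [Fact p.Prime] :
    ¬ ∀ (D : ThetaSetting p) (hC : D.Compat) (K : D.KummerData), Prop15ii K hC := fun h =>
  not_forall_prop15ii_guarded_at p fun D hC _ K => h D hC K

/-- **F-2503, universal closure REFUTED**: Prop. 1.5 (ii) as typed (`ThetaSetting.Prop15ii`) is not true for all
primes, all theta settings, all `Compat` witnesses and all Kummer data. [cite: MochizukiEtTh2009, Prop 1.5 (ii) p.23] -/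
theorem not_forall_prop15ii :
    ¬ ∀ (p : ℕ) [Fact p.Prime] (D : ThetaSetting p) (hC : D.Compat) (K : D.KummerData), Prop15ii K hC :=
  fun h => not_forall_prop15ii_at 2 (h 2)

/-- **F-2503, guarded universal closure REFUTED** (the left-hand side of
`forall_prop15ii_iff_forall_isEmpty_kummerData`). [cite: MochizukiEtTh2009, Prop 1.5 (ii) p.23] -/
theorem not_forall_prop15ii_guarded :
    ¬ ∀ (p : ℕ) [Fact p.Prime] (D : ThetaSetting p) (hC : D.Compat) (_ : D.IsEtThOrigin) (K : D.KummerData),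
        Prop15ii K hC :=
  fun h => not_forall_prop15ii_guarded_at 2 (h 2)

/-- **F-2503, instance level at `modelχ`**: some Kummer datum over the χ-twisted root model violates Prop. 1.5 (ii)
as typed. [cite: MochizukiEtTh2009, Prop 1.5 (ii) p.23] -/
theorem modelχ_exists_not_prop15ii (p : ℕ) [Fact p.Prime] :
    ∃ K : (ThetaSetting.modelχ p).KummerData, ¬ Prop15ii K (ThetaSetting.modelχ p).compat :=
  (exists_not_prop15ii_iff_nonempty_kummerData _ _ (ThetaSetting.modelχ_isEtThOrigin p)).mpr
    (SettingModel.nonempty_kummerData_modelχ p)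

/-- **F-2502 ∧ F-2503 jointly, per prime**: the conjunction of Prop. 1.5 (i) and (ii) as typed fails for some
guarded setting and Kummer datum over every `p`. [cite: MochizukiEtTh2009, Prop 1.5 (ii) p.23] -/
theorem not_forall_prop15i_and_prop15ii_at (p : ℕ) [Fact p.Prime] :
    ¬ ∀ (D : ThetaSetting p) (hC : D.Compat) (K : D.KummerData), Prop15i K hC ∧ Prop15ii K hC := fun h =>
  not_forall_prop15i_at p fun D hC K => (h D hC K).1

/-! ### F-0618 `ConstCompat`: universal closure REFUTED -/

/-- **F-0618, per prime**: the constant-multiple Kummer compatibility `ConstCompat` as typed does NOT hold for all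
theta settings over `p`, all theta-Kummer inputs and all Kummer data (the degenerate input `kummerConst ≡ 1` is
incompatible with `kummerDataχ`). [cite: MochizukiEtTh2009, Prop 1.3 p.21] -/
theorem not_forall_constCompat_at (p : ℕ) [Fact p.Prime] :
    ¬ ∀ (D : ThetaSetting p) (T : D.ThetaKummerInput) (E : D.KummerData), T.ConstCompat E := fun h =>
  not_forall_isEmpty_kummerData_at p fun D => (D.forall_constCompat_iff_isEmpty_kummerData).mp (h D)

/-- **F-0618, universal closure REFUTED**: `ThetaSetting.ThetaKummerInput.ConstCompat` is not true for all primes,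
all theta settings, all theta-Kummer inputs and all Kummer data. [cite: MochizukiEtTh2009, Prop 1.3 p.21] -/
theorem not_forall_constCompat :
    ¬ ∀ (p : ℕ) [Fact p.Prime] (D : ThetaSetting p) (T : D.ThetaKummerInput) (E : D.KummerData),
        T.ConstCompat E :=
  fun h => not_forall_constCompat_at 2 (h 2)

/-- **F-0618, instance level at `modelχ`**: some pair (theta-Kummer input, Kummer datum) over the χ-twisted root
model violates `ConstCompat`. [cite: MochizukiEtTh2009, Prop 1.3 p.21] -/
theorem modelχ_exists_not_constCompat (p : ℕ) [Fact p.Prime] :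
    ∃ (T : (ThetaSetting.modelχ p).ThetaKummerInput) (E : (ThetaSetting.modelχ p).KummerData),
      ¬ T.ConstCompat E :=
  (exists_not_constCompat_iff_nonempty_kummerData _).mpr (SettingModel.nonempty_kummerData_modelχ p)

/-- **F-0618 at the NAMED datum**: some theta-Kummer input over `modelχ` is incompatible with `kummerDataχ` itself.
[cite: MochizukiEtTh2009, Prop 1.3 p.21] -/
theorem kummerDataχ_exists_not_constCompat (p : ℕ) [Fact p.Prime] :
    ∃ T : (ThetaSetting.modelχ p).ThetaKummerInput, ¬ T.ConstCompat (SettingModel.kummerDataχ p) :=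
  (SettingModel.kummerDataχ p).exists_thetaKummerInput_not_constCompat

end ThetaSetting

end Literature.AnabelianGeometry.EtaleTheta

end
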